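import Summits.CriticalPhenomena.PercolationContinuityZ3.Theorems.Transplant.SkelNeg1RootGlueT
import Summits.CriticalPhenomena.PercolationContinuityZ3.Theorems.Transplant.SkelNeg1RootHoldsXE
import Summits.CriticalPhenomena.PercolationContinuityZ3.Theorems.Transplant.SkelNeg1RootHoldsY
import HarnessLib

/-!
# N1 (the `{±1}` node), (R) column (R7): **`RootHoldsNOWFn` AT THE CHOICE FUNCTION OF RECORD** —
# `PlanarSkeletonNeg.rootHoldsNOWFn_negChoiceAllOT_R2 fx Px mx : RootHoldsNOWFn (negChoiceAllOT (NegB.KS.gT 0 NegB.KS.gxR2) (NegB.KS.fT 0 fx) (NegB.KS.PR 0 Px) (NegB.SU NegB.exR2 mx))`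
# (any `fx Px mx`; the node of record — stmt-g14, lane INBOX 2026-08-21T21:17:16Z — has `fx := NegB.fxR`, `mx := NegB.mxR`): the x-instantiation
# `NegB.rootOblTWAt_negBT_x_exR2` (SkelNeg1RootHoldsXE, every `du` with `du.1 = 0`) and the y′-instantiation `NegB.rootOblTWAt_negBT_y_R2` (SkelNeg1RootHoldsY,
# `du.1 = 1`; its box-residual floor `64·(n_b + ℓ_b + |h_b|) ≤ M_L` is why `gx := KS.gxR2` is pinned here) glued by `rootHoldsNOWFn_negChoiceAllOT_of_xy`
# (SkelNeg1RootGlueT). This is the `hR` hypothesis of `samePDropOfSkeletonNeg₁_of_choiceFnNOW` at the tuple of record — ONE of its four hypotheses; NOTHING is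
# claimed here about the open node `SamePDropOfSkeletonNeg₁` itself.

builds on p205010 (kernel theorem, internal audit signed; external expert review pending) — nothing in this file uses p205010.
Lane `prim-bschramm`, seat `prim-bschramm-p3` (gen 10; design owner + (R) owner); helper file (`--supports stmt-CriticalPhenomena-4575 --as helper`).
[cite: KozmaNitzan2024, §4 Theorem 6 (pp. 25–31), p. 28 ((32) at the root)] [cite: MartineauTassion2017, §3.2, §4.3]
-/

noncomputable section

open scoped Classical

namespace Summit.CriticalPhenomena.PercolationContinuityZ3.Theorems.Transplant

namespace PlanarSkeletonNeg

/-- **`RootHoldsNOWFn` of the choice function of record** (`gx := KS.gxR2`, `ex := exR2`; any `fx Px mx`). [cite: KozmaNitzan2024, §4 p. 28 ((32) at the root)] -/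
theorem rootHoldsNOWFn_negChoiceAllOT_R2 (fx : Neg.FSlot) (Px : NegB.PSlot) (mx : NegB.GSlot) :
    RootHoldsNOWFn (negChoiceAllOT (NegB.KS.gT 0 NegB.KS.gxR2) (NegB.KS.fT 0 fx) (NegB.KS.PR 0 Px) (NegB.SU NegB.exR2 mx)) :=
  rootHoldsNOWFn_negChoiceAllOT_of_xy _ _ _ _
    (fun _ _ _ _ _ _ _ _ _ _ _ _ hAt h1 hp0 hp1 du hd => NegB.rootOblTWAt_negBT_x_exR2 NegB.KS.gxR2 fx Px mx hAt h1 hp0 hp1 du hd)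
    (fun _ _ _ _ _ _ _ _ _ _ _ _ hAt h1 hp0 hp1 du hd => NegB.rootOblTWAt_negBT_y_R2 fx Px mx hAt h1 hp0 hp1 du hd)

end PlanarSkeletonNeg

end Summit.CriticalPhenomena.PercolationContinuityZ3.Theorems.Transplant

end
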